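import Summits.QuantumAdvantage.AdviceFreeQNC0.FibreDecimation37NHSFibre
import HarnessLib

/-!
# Cell qa-qnc0, `p = 3` — ROUND-37P2 §3.8 (ii): **`FibreNonExact37NHS` for `m ≥ 3`** — fibre non-exactness for a MIXED population
# (generic MOD-3 tests + an ARBITRARY Boolean function of `R` label forms), constant loss `2^{−(m+3)}`

Planner qa-qnc0-p2 g37, ROUND-37P2 §3.8 (ii) ("the state of the art of this line"; p1 g38: "THE assembly shape for (J3)_{r=1}"),
typed verbatim as `Exp37.FibreNonExact37NHS` (`FibreDecimation37.lean` v3): under (NH/S) — the decimated generic code TOGETHER WITH the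
span of the label forms `S` is not `3/4`-heavy on `Y` — the parity `f(u) + [h(⟨S_1,u⟩,…,⟨S_R,u⟩)]` (`h` arbitrary: the seeded
sub-family's whole contribution, tables, signs and all) agrees with any `𝔽₂`-affine target on at most `(1 − 2^{−m−3})·2^{z−1}` points
of the parity coset.

* **`fibreNonExact37NHS_of_three_le`** — the typed statement plus `3 ≤ m` (for `m = 1` it is false for the same reason as
  `FibreNonExact37NH`, see `FibreDecimation37NH.lean`).  Proof: STEP 1 as in 37.F′; STEP 2 = `good_fibre_parity_label` (Lemma 37.D
  with the label term carried through `L_a` as one element `G(σ(y))`); STEP 3′ = `card_parityClass_filter_label_le` (Parseval on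
  `𝔽₃^{J} × 𝔽₃^R`, Cauchy–Schwarz against the (NH/S) sum).  No expansion of a WIN indicator occurs (B-37P2.2 evaded, as designed).

WHAT THIS IS NOT: §3.8 (iii)–(v) (comparison with the pure seeded strategy, the open regime) and Corollary 37.C are untouched;
crux 22907 (`RingDenseResidualLt3`) untouched; no separation claim.
-/

noncomputable section

namespace Summit.QuantumAdvantage.AdviceFreeQNC0.Exp37

open Finset
open Summit.QuantumAdvantage.AdviceFreeQNC0 F4
open Literature.Computability.MetaComplexity.ModTestProduct

/-- **ROUND-37P2 §3.8 (ii) (`FibreNonExact37NHS`) for odd `m ≥ 3` — PROVED.**  Generic tests `β` (dense test `k₀` with pattern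
`a` on the chosen coins) plus an arbitrary Boolean function `h` of `R` label forms `S`: under (NH/S) every `𝔽₂`-affine target is
missed on at least a `2^{−(m+3)}` fraction of the parity coset. -/
theorem fibreNonExact37NHS_of_three_le (z s m R : ℕ) (ι : Fin m ↪ Fin z) (β : Fin s → Fin z → ZMod 3)
    (r : Fin s → ZMod 3) (k₀ : Fin s) (a : Fin m → Bool) (S : Fin R → Fin z → ZMod 3) (h : (Fin R → ZMod 3) → Bool)
    (hm : Odd m) (h3 : 3 ≤ m) (hz : 1 ≤ z - m) (hβ : ∀ i, β k₀ (ι i) = lettZ (a i)) (hNHS : NHSCond ι a β S)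
    (ε μ₀ : ℕ) (T : Finset (Fin z)) :
    (((coset z ε).filter fun u =>
        (testParity β r u + (if h (labelVal S u) then 1 else 0)) % 2 = affTarget μ₀ T u % 2).card : ℝ)
      ≤ (1 - (2 : ℝ)⁻¹ ^ (m + 3)) * (2 : ℝ) ^ (z - 1) := by
  classical
  -- the coset, its agreement and disagreement parts
  set agree : (Fin z → Bool) → Prop := fun u =>
    (testParity β r u + (if h (labelVal S u) then 1 else 0)) % 2 = affTarget μ₀ T u % 2 with hagree
  have hHcard : ((coset z ε).card : ℝ) = (2 : ℝ) ^ (z - 1) := by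
    have hc := card_parityClass (ι := Fin z) (by rw [Fintype.card_fin]; omega) ε
    rw [Fintype.card_fin] at hc
    exact hc
  have hsplitH := card_filter_add_card_filter_not (s := coset z ε) agree
  set D : Finset (Fin z → Bool) := (coset z ε).filter fun u => ¬ agree u with hD
  -- the outside cube and its even half
  have hn : Fintype.card (Out ι) = z - m := card_out ι
  have hnpos : 0 < Fintype.card (Out ι) := by rw [hn]; exact hz
  set Yev : Finset (Out ι → Bool) := univ.filter fun y => (univ.filter fun c => y c = true).card % 2 = 0 % 2 with hYev
  have hYcard : (Yev.card : ℝ) = (2 : ℝ) ^ (z - m - 1) := by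
    rw [← hn]; exact card_parityClass hnpos 0
  -- STEP 1: even `y` above which some point of the coset disagrees inject into `D`
  set res : (Fin z → Bool) → (Out ι → Bool) := fun u c => u c.1 with hres
  set Bset : Finset (Out ι → Bool) := Yev.filter fun y => ∃ u ∈ D, res u = y with hBset
  set Good : Finset (Out ι → Bool) := Yev.filter fun y => ¬ ∃ u ∈ D, res u = y with hGood
  have hsplitY := card_filter_add_card_filter_not (s := Yev) (fun y => ∃ u ∈ D, res u = y)
  have hBD : Bset.card ≤ D.card := by
    refine Finset.card_le_card_of_injOn
      (fun y => if hy : ∃ u ∈ D, res u = y then hy.choose else fun _ => false) (fun y hy => ?_) ?_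
    · obtain ⟨-, hy'⟩ := mem_filter.1 hy
      simp only [dif_pos hy']
      exact hy'.choose_spec.1
    · intro y hy y' hy' heq
      obtain ⟨-, h1⟩ := mem_filter.1 (mem_coe.1 hy)
      obtain ⟨-, h1'⟩ := mem_filter.1 (mem_coe.1 hy')
      simp only [dif_pos h1, dif_pos h1'] at heq
      calc y = res h1.choose := h1.choose_spec.2.symm
        _ = res h1'.choose := by rw [heq]
        _ = y' := h1'.choose_spec.2
  -- STEP 2 + 3′: good `y` satisfy the decoded parity relation (with the label bit), which holds for few `y`
  have hGoodP : Good ⊆ univ.filter fun y : Out ι → Bool =>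
      (univ.filter fun c => y c = true).card % 2 = 0 % 2 ∧
        ((univ.filter fun k => subsetSum (dirOut ι β k) y ∈ accSet ι β r a ε k).card +
          (if gLab a ε ι S h (fun i => subsetSum (dirOut ι S i) y) then 1 else 0)) % 2 = cStar ι a ε T % 2 := by
    intro y hy
    obtain ⟨hyev, hgood⟩ := mem_filter.1 hy
    obtain ⟨-, hy0⟩ := mem_filter.1 hyev
    refine mem_filter.2 ⟨mem_univ _, hy0, ?_⟩
    refine good_fibre_parity_label ι β r a μ₀ ε T S h hm y (by omega) fun u hu hres' => ?_
    by_contra hne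
    exact hgood ⟨u, mem_filter.2 ⟨hu, hne⟩, hres'⟩
  obtain ⟨hk₀, hk₀'⟩ := accSet_pattern_genuine ι β r a ε hm (by omega) k₀ hβ
  have hP := card_parityClass_filter_label_le (dirOut ι β) (accSet ι β r a ε) (decimSet ι a β)
    (accSet_eq_empty_of_not_mem_decimSet ι β r a ε hm) k₀ hk₀ hk₀' (dirOut ι S) (gLab a ε ι S h) hnpos
    (nhs_weight_sum_le ι a β S hNHS _ fun jγ => by simp only [mem_filter, mem_univ, true_and]) 0 (cStar ι a ε T)
  rw [hn] at hP
  have hGoodNat : Good.card ≤ _ := card_le_card hGoodP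
  have hGood : (Good.card : ℝ) ≤ 7 / 8 * (2 : ℝ) ^ (z - m - 1) := (Nat.cast_le.2 hGoodNat).trans hP
  -- assembly
  have hsplitHR : (((coset z ε).filter agree).card : ℝ) + (D.card : ℝ) = (2 : ℝ) ^ (z - 1) := by
    rw [← hHcard]; exact_mod_cast hsplitH
  have hsplitYR : (Bset.card : ℝ) + (Good.card : ℝ) = (2 : ℝ) ^ (z - m - 1) := by
    rw [← hYcard]; exact_mod_cast hsplitY
  have hBDR : (Bset.card : ℝ) ≤ (D.card : ℝ) := by exact_mod_cast hBD
  have hpow : (2 : ℝ) ^ (z - 1) = (2 : ℝ) ^ m * (2 : ℝ) ^ (z - m - 1) := by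
    rw [← pow_add]; congr 1; omega
  have hinv : (2 : ℝ)⁻¹ ^ (m + 3) * ((2 : ℝ) ^ m * (2 : ℝ) ^ (z - m - 1)) = (2 : ℝ) ^ (z - m - 1) / 8 := by
    obtain ⟨X, hX⟩ : ∃ X : ℝ, X = (2 : ℝ)⁻¹ ^ (m + 3) := ⟨_, rfl⟩
    have h1 : X * (2 : ℝ) ^ (m + 3) = 1 := by
      rw [hX, ← mul_pow]; norm_num
    have h28 : (2 : ℝ) ^ (m + 3) = (2 : ℝ) ^ m * 8 := by rw [pow_add]; norm_num
    rw [h28] at h1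
    rw [← hX]
    calc X * ((2 : ℝ) ^ m * (2 : ℝ) ^ (z - m - 1)) = X * ((2 : ℝ) ^ m * 8) * (2 : ℝ) ^ (z - m - 1) / 8 := by ring
      _ = (2 : ℝ) ^ (z - m - 1) / 8 := by rw [h1, one_mul]
  rw [show (((coset z ε).filter fun u =>
      (testParity β r u + (if h (labelVal S u) then 1 else 0)) % 2 = affTarget μ₀ T u % 2).card : ℝ) =
      (((coset z ε).filter agree).card : ℝ) from rfl]
  rw [hpow, sub_mul, one_mul, hinv]
  linarith

end Summit.QuantumAdvantage.AdviceFreeQNC0.Exp37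

end
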